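import Summits.NavierStokesRegularity.FunctionalMining.NoGo.GalerkinReduction
import HarnessLib

/-!
# Functional mining NO-GO, Part C(ii): no sub-cubic differential budget for quadratic Fourier energies; the universal three-wave witness

Search for candidate a priori estimates; no regularity claim. Third of three modules filed
verbatim from the no-go seat's `NoGo.lean` (see `FunctionalMining/NoGo/BudgetedSieves.lean` for the
full module documentation of Parts A–C); declarations unchanged.
-/

noncomputable section

open Filter
open scoped Topology

namespace Summit.NavierStokesRegularity.FunctionalMining

namespace Galerkin

open Literature.Analysis.FluidPDE.FluidComputer
open Literature.Analysis.FluidPDE.FluidComputer.ShellTransfer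
open Literature.Analysis.FluidPDE.FluidComputer.ShellTransfer.TaylorGreenHat (scale scale_coeff)
open Literature.Analysis.FluidPDE.FluidComputer.ShellTransfer.ThreeWaves (tw B)
open Complex ComplexConjugate Finset
open scoped BigOperators

/-! ### The no-go for quadratic Fourier energies -/

/-- **Part A applied to the Galerkin system.** On a finite symmetric mode set `S`, `ν ≥ 0`: if a
quadratic Fourier energy `F_w` obeys a differential budget `dF_w/dt ≤ Θ` with `Θ` SUB-CUBIC along
every unforced Galerkin solution on `S`, then its truncated Euler production `T_w` vanishes at
EVERY datum supported in `S` (`F_w` is a formal invariant of the truncated Euler system on `S`).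
[folklore] -/
theorem weightedTransfer_eq_zero_of_holds {S : Finset (Fin 3 → ℤ)} (hS : ∀ k ∈ S, -k ∈ S)
    {ν : ℝ} (hν : 0 ≤ ν) {w : (Fin 3 → ℤ) → ℝ} {Θ : FourierVelocity → ℝ} (hΘ : SubcubicOn S Θ)
    (h : HoldsAlongGalerkin S ν (fun U => weightedEnergy w U S) Θ) :
    ∀ V : FourierVelocity, (∀ p ∉ S, V.coeff p = 0) → weightedTransfer w V S = 0 := by
  obtain ⟨q, hq, hC⟩ := hΘ
  have hred := rate_le_of_holdsAlongGalerkin hS hν (F := fun U => weightedEnergy w U S) (Θ := Θ)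
    (R := fun U => -(2 * ν) * weightedDissipation w U S + weightedTransfer w U S)
    (fun U c hU _ t => hasDerivAt_weightedEnergy_galerkin w hU t) h
  have key := inertial_eq_zero_of_rate_le (X := FourierVelocity)
    (P := fun V => ∀ p ∉ S, V.coeff p = 0) (amp := scale) (neg := scale (-1))
    (V := fun U => -(2 : ℝ) * weightedDissipation w U S) (I := fun U => -weightedTransfer w U S)
    (Θ := Θ) (ν := ν) (m := 2) (q := q)
    (fun A V _ hV p hp => scale_coeff_eq_zero (hV p hp) A)
    (fun V hV p hp => scale_coeff_eq_zero (hV p hp) (-1))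
    (fun A V _ =>
      show -(2 : ℝ) * weightedDissipation w (scale A V) S = A ^ (2 : ℝ) * (-(2 : ℝ) * weightedDissipation w V S) by
        rw [weightedDissipation_scale, Real.rpow_two]
        ring)
    (fun A V _ =>
      show -weightedTransfer w (scale A V) S = A ^ ((2 : ℝ) + 1) * -weightedTransfer w V S by
        rw [weightedTransfer_scale, show (2 : ℝ) + 1 = ((3 : ℕ) : ℝ) by norm_num, Real.rpow_natCast]
        ring)
    (fun V =>
      show -(2 : ℝ) * weightedDissipation w (scale (-1) V) S = -(2 : ℝ) * weightedDissipation w V S by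
        rw [weightedDissipation_scale]
        norm_num)
    (fun V =>
      show -weightedTransfer w (scale (-1) V) S = -(-weightedTransfer w V S) by
        rw [weightedTransfer_scale]
        norm_num)
    hC (by linarith)
    (fun V hV => by
      have h' : -(2 * ν) * weightedDissipation w V S + weightedTransfer w V S ≤ Θ V := hred V hV
      show ν * (-(2 : ℝ) * weightedDissipation w V S) - -weightedTransfer w V S ≤ Θ V
      linarith)
  intro V hV
  have h0 : -weightedTransfer w V S = 0 := key V hV
  exact neg_eq_zero.mp h0

/-- **Critical budgets (Galerkin): the row is the static inequality `T_w ≤ Θtop`.** If the budget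
grows along amplitude rays like `A³·Θtop + O(A^q)`, `q < 3`, then the row `dF_w/dt ≤ Θ` along all
unforced Galerkin solutions on a symmetric `S` (`ν ≥ 0`) forces `T_w(V) ≤ Θtop(V)` at every datum
supported in `S` — viscosity has dropped out (Part A, `neg_inertial_le_of_rate_le_critical`). This
is the Galerkin form of "conditional-rate (T_C) rows are static functional inequalities". [folklore] -/
theorem weightedTransfer_le_of_holds_critical {S : Finset (Fin 3 → ℤ)} (hS : ∀ k ∈ S, -k ∈ S)
    {ν : ℝ} (hν : 0 ≤ ν) (w : (Fin 3 → ℤ) → ℝ) {Θ Θtop : FourierVelocity → ℝ} {q : ℝ} (hq : q < 3)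
    (hC : ∀ V : FourierVelocity, (∀ p ∉ S, V.coeff p = 0) →
      ∃ C : ℝ, ∀ A : ℝ, 1 ≤ A → Θ (scale A V) ≤ A ^ (3 : ℝ) * Θtop V + C * A ^ q)
    (h : HoldsAlongGalerkin S ν (fun U => weightedEnergy w U S) Θ) :
    ∀ V : FourierVelocity, (∀ p ∉ S, V.coeff p = 0) → weightedTransfer w V S ≤ Θtop V := by
  have hred := rate_le_of_holdsAlongGalerkin hS hν (F := fun U => weightedEnergy w U S)
    (R := fun U => -(2 * ν) * weightedDissipation w U S + weightedTransfer w U S)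
    (fun U c hU _ t => hasDerivAt_weightedEnergy_galerkin w hU t) h
  have key := neg_inertial_le_of_rate_le_critical (X := FourierVelocity)
    (P := fun V => ∀ p ∉ S, V.coeff p = 0) (amp := fun A V => scale A V)
    (V := fun U => -(2 : ℝ) * weightedDissipation w U S) (I := fun U => -weightedTransfer w U S)
    (Θ := Θ) (Θtop := Θtop) (ν := ν) (m := 2) (q := q)
    (fun A V _ hV p hp => scale_coeff_eq_zero (hV p hp) A)
    (fun A V _ =>
      show -(2 : ℝ) * weightedDissipation w (scale A V) S = A ^ (2 : ℝ) * (-(2 : ℝ) * weightedDissipation w V S) by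
        rw [weightedDissipation_scale, Real.rpow_two]
        ring)
    (fun A V _ =>
      show -weightedTransfer w (scale A V) S = A ^ ((2 : ℝ) + 1) * -weightedTransfer w V S by
        rw [weightedTransfer_scale, show (2 : ℝ) + 1 = ((3 : ℕ) : ℝ) by norm_num, Real.rpow_natCast]
        ring)
    (fun V hV => by
      obtain ⟨C, hC'⟩ := hC V hV
      exact ⟨C, fun A hA => by rw [show (2 : ℝ) + 1 = 3 by norm_num]; exact hC' A hA⟩)
    (by linarith)
    (fun V hV => by
      have h' : -(2 * ν) * weightedDissipation w V S + weightedTransfer w V S ≤ Θ V := hred V hV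
      show ν * (-(2 : ℝ) * weightedDissipation w V S) - -weightedTransfer w V S ≤ Θ V
      linarith)
  intro V hV
  have h0 : -(-weightedTransfer w V S) ≤ Θtop V := key V hV
  rwa [neg_neg] at h0

/-- **No-go from one witness.** Under the same hypotheses, a single datum `V` supported in `S` with
`T_w(V) ≠ 0` refutes the row `dF_w/dt ≤ Θ` for EVERY sub-cubic `Θ` and every `ν ≥ 0`. [folklore] -/
theorem not_holdsAlongGalerkin_of_witness {S : Finset (Fin 3 → ℤ)} (hS : ∀ k ∈ S, -k ∈ S)
    {ν : ℝ} (hν : 0 ≤ ν) {w : (Fin 3 → ℤ) → ℝ} {Θ : FourierVelocity → ℝ} (hΘ : SubcubicOn S Θ)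
    {V : FourierVelocity} (hV : ∀ p ∉ S, V.coeff p = 0) (hwit : weightedTransfer w V S ≠ 0) :
    ¬ HoldsAlongGalerkin S ν (fun U => weightedEnergy w U S) Θ :=
  fun h => hwit (weightedTransfer_eq_zero_of_holds hS hν hΘ h V hV)

/-! ### The universal witness: the three-wave field -/

/-- On the box `B = {0,±1}²×{0}` every mode has `|k|² = 1`, `|k|² = 2`, or carries no coefficient of
the three-wave field. [folklore] -/
theorem knormSq_cases_of_mem_B {k : Fin 3 → ℤ} (hk : k ∈ B) :
    knormSq k = 1 ∨ knormSq k = 2 ∨ tw.coeff k = 0 := by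
  obtain ⟨h0, h1, h2⟩ := ThreeWaves.mem_B.mp hk
  have hn : knormSq k = ((k 0 : ℤ) : ℝ) ^ 2 + ((k 1 : ℤ) : ℝ) ^ 2 := by
    simp [knormSq, Fin.sum_univ_three, h2]
  rcases ThreeWaves.mem_zpm.mp h0 with e0 | e0 | e0 <;>
    rcases ThreeWaves.mem_zpm.mp h1 with e1 | e1 | e1
  · right; right
    funext j
    rw [ThreeWaves.coeff_eq_ite, if_pos hk, e0, e1]
    simp [ThreeWaves.vecFun]
  · left; rw [hn, e0, e1]; norm_num
  · left; rw [hn, e0, e1]; norm_num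
  · left; rw [hn, e0, e1]; norm_num
  · right; left; rw [hn, e0, e1]; norm_num
  · right; left; rw [hn, e0, e1]; norm_num
  · left; rw [hn, e0, e1]; norm_num
  · right; left; rw [hn, e0, e1]; norm_num
  · right; left; rw [hn, e0, e1]; norm_num

/-- **Production of the three-wave field against ANY radial weight**: for `w(k) = φ(|k|²)` and
every mode set `S ⊇ B`, `T_w(tw) = 2(φ(2) − φ(1))` (from `T_Z(tw) = 2`, `Σ_k T(k) = 0`, and the
support of `tw` on the shells `|k|² ∈ {1, 2}`). Enstrophy: `φ = id`, `T = 2`; `Ḣ^s`: `φ(x) = x^s`,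
`T = 2(2^s − 1)`; energy: `φ = 1`, `T = 0`. [folklore] -/
theorem weightedTransfer_tw_radial (φ : ℝ → ℝ) {S : Finset (Fin 3 → ℤ)} (hS : B ⊆ S) :
    weightedTransfer (fun k => φ (knormSq k)) tw S = 2 * (φ 2 - φ 1) := by
  have h1 : weightedTransfer (fun k => φ (knormSq k)) tw S =
      ∑ k ∈ B, φ (knormSq k) * energyRate tw B k := by
    unfold weightedTransfer
    rw [Finset.sum_congr rfl fun k _ => by rw [ThreeWaves.energyRate_tw_eq hS k]]
    symm
    refine Finset.sum_subset hS fun k _ hk => ?_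
    rw [energyRate_eq_zero_of_coeff tw B (ThreeWaves.coeff_of_not_mem hk), mul_zero]
  have h2 : ∑ k ∈ B, φ (knormSq k) * energyRate tw B k =
      ∑ k ∈ B, ((2 * φ 1 - φ 2) + (φ 2 - φ 1) * knormSq k) * energyRate tw B k := by
    refine Finset.sum_congr rfl fun k hk => ?_
    rcases knormSq_cases_of_mem_B hk with h | h | h
    · rw [h]; ring
    · rw [h]; ring
    · rw [energyRate_eq_zero_of_coeff tw B h, mul_zero, mul_zero]
  have h3 : ∑ k ∈ B, ((2 * φ 1 - φ 2) + (φ 2 - φ 1) * knormSq k) * energyRate tw B k =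
      (2 * φ 1 - φ 2) * ∑ k ∈ B, energyRate tw B k + (φ 2 - φ 1) * enstrophyTransfer tw B := by
    unfold enstrophyTransfer
    rw [Finset.mul_sum, Finset.mul_sum, ← Finset.sum_add_distrib]
    refine Finset.sum_congr rfl fun k _ => ?_
    ring
  rw [h1, h2, h3, sum_energyRate_eq_zero tw B, ThreeWaves.enstrophyTransfer_tw_B]
  ring

/-- `tw` is supported in every `S ⊇ B`. [folklore] -/
theorem tw_supported {S : Finset (Fin 3 → ℤ)} (hS : B ⊆ S) : ∀ p ∉ S, tw.coeff p = 0 :=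
  fun _ hp => ThreeWaves.coeff_of_not_mem fun h => hp (hS h)

/-- **NO-GO FOR RADIAL QUADRATIC ENERGIES (Galerkin).** For every finite symmetric mode set
`S ⊇ B`, every viscosity `ν ≥ 0`, every radial weight `w(k) = φ(|k|²)` with `φ 1 ≠ φ 2`, and every
SUB-CUBIC budget `Θ`, the census row "`d/dt Σ_{k∈S} φ(|k|²)·½|û(k)|² ≤ Θ` along every unforced
Galerkin solution on `S`" is FALSE — refuted through the three-wave field (one datum; Part A scales
and reflects it). Search for candidate a priori estimates; no regularity claim. [folklore] -/
theorem radial_noGo {S : Finset (Fin 3 → ℤ)} (hS : ∀ k ∈ S, -k ∈ S) (hB : B ⊆ S) {ν : ℝ}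
    (hν : 0 ≤ ν) (φ : ℝ → ℝ) (hφ : φ 1 ≠ φ 2) {Θ : FourierVelocity → ℝ} (hΘ : SubcubicOn S Θ) :
    ¬ HoldsAlongGalerkin S ν (fun U => weightedEnergy (fun k => φ (knormSq k)) U S) Θ :=
  not_holdsAlongGalerkin_of_witness hS hν hΘ (tw_supported hB) (by
    rw [weightedTransfer_tw_radial φ hB]
    intro h
    apply hφ
    linarith)

/-- **The enstrophy instance.** On every finite symmetric `S ⊇ B`, `ν ≥ 0`: the truncated enstrophy
`Z_S` obeys NO sub-cubic differential budget along all unforced Galerkin solutions. [folklore] -/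
theorem enstrophy_noGo {S : Finset (Fin 3 → ℤ)} (hS : ∀ k ∈ S, -k ∈ S) (hB : B ⊆ S) {ν : ℝ}
    (hν : 0 ≤ ν) {Θ : FourierVelocity → ℝ} (hΘ : SubcubicOn S Θ) :
    ¬ HoldsAlongGalerkin S ν (fun U => truncEnstrophy U S) Θ :=
  radial_noGo hS hB hν id (by norm_num) hΘ

/-- **The linear Grönwall budget for the enstrophy fails on every truncation**: for every `K` and
every `ν ≥ 0` there is an unforced Galerkin solution on `S ⊇ B` along which `dZ_S/dt ≤ K·Z_S`
fails at some time. [folklore] -/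
theorem enstrophy_linearBudget_noGo {S : Finset (Fin 3 → ℤ)} (hS : ∀ k ∈ S, -k ∈ S) (hB : B ⊆ S)
    {ν : ℝ} (hν : 0 ≤ ν) (K : ℝ) :
    ¬ HoldsAlongGalerkin S ν (fun U => truncEnstrophy U S) fun U => K * truncEnstrophy U S := by
  intro h
  -- enlarge to the non-negative multiple `|K|·Z_S`, which is sub-cubic (degree 2)
  have h' : HoldsAlongGalerkin S ν (fun U => truncEnstrophy U S) fun U => |K| * truncEnstrophy U S :=
    h.mono fun V => mul_le_mul_of_nonneg_right (le_abs_self K) (truncEnstrophy_nonneg V S)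
  refine enstrophy_noGo hS hB hν ?_ h'
  exact SubcubicOn.const_mul
    (subcubicOn_of_homogeneous (q := 2) (by norm_num) fun V A _ =>
      show truncEnstrophy (scale A V) S = A ^ (2 : ℝ) * truncEnstrophy V S by
        rw [truncEnstrophy_scale, Real.rpow_two]) (abs_nonneg K)

/-- **The `Ḣ^s`-energy instance** (`w(k) = (|k|²)^s`, `s ≠ 0`): no sub-cubic differential budget on
any finite symmetric `S ⊇ B`. [folklore] -/
theorem sobolevEnergy_noGo {S : Finset (Fin 3 → ℤ)} (hS : ∀ k ∈ S, -k ∈ S) (hB : B ⊆ S) {ν : ℝ}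
    (hν : 0 ≤ ν) {s : ℝ} (hs : s ≠ 0) {Θ : FourierVelocity → ℝ} (hΘ : SubcubicOn S Θ) :
    ¬ HoldsAlongGalerkin S ν (fun U => weightedEnergy (fun k => knormSq k ^ s) U S) Θ := by
  refine radial_noGo hS hB hν (fun x => x ^ s) ?_ hΘ
  show (1 : ℝ) ^ s ≠ (2 : ℝ) ^ s
  rw [Real.one_rpow]
  rcases lt_or_gt_of_ne hs with hneg | hpos
  · exact (Real.rpow_lt_one_of_one_lt_of_neg (by norm_num) hneg).ne'
  · exact (Real.one_lt_rpow (by norm_num) hpos).ne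

end Galerkin

end Summit.NavierStokesRegularity.FunctionalMining

end
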